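import Summits.Ventures.HSemireg.Mod4IdealShapeInnerPins
import Summits.Ventures.HSemireg.Mod4IdealShapePinZeroOdd

/-!
# Venture HSemireg — MOD-4 line: the `I_Z`-SHAPE h-parts at EVERY `O_Z` pin of an ODD `n` — `det(T_f(q) ∓ μ_a) =
# (−1)ⁿ q_0 · det TL_a · det R_a`: the pin value `±μ_a` survives as an eigenvalue of `T_f` exactly on two hypersurfaces

HONEST FRAMING. Part of the Lean index of the computation cell `pub-hsemireg` (seat w3-mod4-1 gen 15, W3 SPECIAL FIBRES; file of
record `HOME/widen/W3/MOD4-OFFSPLIT-w3mod4.md` §13.41). `Mod4IdealShapeInnerPins` did the even-`n` inner pins (three blocks, the zero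
pivots `a` and `n − a` of `T_f(q⁰) − μ_a`); for ODD `n` the pivot at `n − a` is `−2μ_a ≠ 0`, so only the pivot at `a` vanishes and the
Hessenberg matrix splits into TWO blocks. ELEMENTARY LINEAR ALGEBRA over a field ONLY: no abelian variety, no sheaf, no Ext group,
no semiregularity map; nothing here says that HC / HC_CM / HC_AV holds; no Literature fact is declared; NO definition is introduced.

SETTING: `n = a + k` odd (`a ≤ n`), `I_Z` shape (`q_m = 0` for `1 ≤ m < n`; `q_0`, `q_n`, tail arbitrary), `q⁰ = q[0 ↦ 0]`,
`μ_a = (−1)^a C(n,a) q_n`, `N = T_f(q⁰) − μ_a` (upper triangular; its only zero pivot is at `a`), `Ñ = (N_{r,s+1})_{r,s<n}`; blocks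
`TL_a = (N_{i,1+j})_{i,j<a}` and `R_a = (N_{a+i, a+1+j})_{i,j<k}` (hypothesis-bound `Matrix.of`). WHAT IS PROVED:
* **`hankelT_sub_pin_diag_odd`** — odd `n`: `N_{aa} = 0` and `N_{bb} ≠ 0` for `b ≠ a` (`q_n ≠ 0`);
* **`det_hessenberg_pin_eq_odd`** — `det Ñ = det TL_a · det R_a`;
* **`det_hankelT_idealShape_sub_pin_odd`** — `det(T_f(q) − μ_a) = (−1)ⁿ q_0 · (det TL_a · det R_a)`; with `Mod4IdealShapePinZeroOdd`'s
  `det(T_f + c) = det(T_f − c)` the same scalar is `det(T_f(q) + μ_a)`;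
* **`ker_hankelT_idealShape_sub_pin_odd_ne_bot_iff`** — `q_0 ≠ 0`: `μ_a` (equivalently `−μ_a`) is an eigenvalue of `T_f(q)` iff
  `det TL_a · det R_a = 0`.
READING: on a Weil `(4c+2)`-fold the `I_Z` row keeps the `O_Z` pin value `μ_a` exactly on the union of two hypersurfaces `det TL_a = 0`,
`det R_a = 0`; for `a = 0` (`TL` empty) this is `Mod4IdealShapePinZeroOdd`'s `det B⁻ = 0`. The multiplicities at inner pins are not
treated. Everything PROVED, 0 sorry. Namespace `Summit.Ventures.HSemireg.Mod4`. References: [BourbakiAlgebre1a3] Ch. III §8;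
[BuchweitzFlenner2008HH] Prop. 6.4.4 (why these matrices).
-/

namespace Summit.Ventures.HSemireg.Mod4

open Finset Matrix

variable {K : Type*} [Field K]

/-- **odd `n`: the pivots of `T_f(q) − μ_a` for a leading shape** — zero at `a`, non-zero at every `b ≠ a` (`q_n ≠ 0`; at `b = n − a`
the pivot is `((−1)^{n−a} − (−1)^a) C(n,a) q_n = −2μ_a`). [cite: BourbakiAlgebre1a3, Ch. III §8] -/
theorem hankelT_sub_pin_diag_odd [CharZero K] {n a : ℕ} (ha : a ≤ n) (hodd : Odd n) {q : ℕ → K} (hqn : q n ≠ 0) {μ : K}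
    (hμ : μ = (-1 : K) ^ a * (n.choose a : K) * q n) :
    (hankelT n q - μ • (1 : Matrix (Fin (n + 1)) (Fin (n + 1)) K)) ⟨a, by omega⟩ ⟨a, by omega⟩ = 0 ∧
    ∀ b : Fin (n + 1), (b : ℕ) ≠ a → (hankelT n q - μ • (1 : Matrix (Fin (n + 1)) (Fin (n + 1)) K)) b b ≠ 0 := by
  have hdiag : ∀ b : Fin (n + 1), (hankelT n q - μ • (1 : Matrix (Fin (n + 1)) (Fin (n + 1)) K)) b b =
      (-1 : K) ^ (b : ℕ) * (n.choose (b : ℕ) : K) * q n - μ := by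
    intro b
    have hb := b.isLt
    rw [Matrix.sub_apply, Matrix.smul_apply, Matrix.one_apply_eq, smul_eq_mul, mul_one, hankelT_apply,
      show n - (b : ℕ) + (b : ℕ) = n by omega]
  refine ⟨by rw [hdiag, hμ]; exact sub_self _, fun b hba => ?_⟩
  have hb := b.isLt
  rw [hdiag, hμ]
  by_cases hbn : (b : ℕ) + a = n
  · -- `b = n − a ≠ a` (odd `n`): the two signs differ
    intro h
    have h1 : ((-1 : K) ^ (b : ℕ) * (n.choose (b : ℕ) : K) - (-1 : K) ^ a * (n.choose a : K)) * q n = 0 := by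
      linear_combination h
    have h2 := (mul_eq_zero.mp h1).resolve_right hqn
    rw [show n.choose (b : ℕ) = n.choose a from (Nat.choose_symm_of_eq_add hbn.symm).symm ▸ rfl] at h2
    have hpar : (-1 : K) ^ (b : ℕ) = -((-1 : K) ^ a) := by
      obtain ⟨m, hm⟩ := hodd
      have hsum : (-1 : K) ^ (b : ℕ) * (-1 : K) ^ a = -1 := by
        rw [← pow_add, show (b : ℕ) + a = 2 * m + 1 by omega, pow_succ, pow_mul, neg_one_sq, one_pow, one_mul]
      have hsq : (-1 : K) ^ a * (-1 : K) ^ a = 1 := by rw [← pow_add, ← two_mul, pow_mul, neg_one_sq, one_pow]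
      linear_combination (-1 : K) ^ a * hsum - (-1 : K) ^ (b : ℕ) * hsq
    rw [hpar] at h2
    have h3 : (2 : K) * ((-1 : K) ^ a * (n.choose a : K)) = 0 := by linear_combination -h2
    rcases mul_eq_zero.mp h3 with h4 | h4
    · exact absurd h4 two_ne_zero
    · exact absurd h4 (mul_ne_zero (pow_ne_zero _ (neg_ne_zero.mpr one_ne_zero))
        (Nat.cast_ne_zero.mpr (Nat.choose_pos ha).ne'))
  · exact hankelT_leading_diag_sub_ne_zero hqn (Nat.le_of_lt_succ hb) ha (by omega)

/-- **odd `n = a + k`: the Hessenberg matrix `Ñ = (N_{r,s+1})` of `N = T_f(q⁰) − μ_a` factors through TWO diagonal blocks**,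
`det Ñ = det TL_a · det R_a` (the only zero sub-diagonal entry of `Ñ` is at `a`). [cite: BourbakiAlgebre1a3, Ch. III §8] -/
theorem det_hessenberg_pin_eq_odd [CharZero K] {n a k : ℕ} (hn : n = a + k) (hodd : Odd n) {q : ℕ → K}
    (hq0 : ∀ m, m < n → q m = 0) (hqn : q n ≠ 0) {μ : K} (hμ : μ = (-1 : K) ^ a * (n.choose a : K) * q n)
    {NN : Matrix (Fin n) (Fin n) K}
    (hNN : NN = Matrix.of fun r s : Fin n =>
      (hankelT n q - μ • (1 : Matrix (Fin (n + 1)) (Fin (n + 1)) K)) (Fin.castSucc r) (Fin.succ s))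
    {TL : Matrix (Fin a) (Fin a) K}
    (hTL : TL = Matrix.of fun i j : Fin a =>
      (hankelT n q - μ • (1 : Matrix (Fin (n + 1)) (Fin (n + 1)) K)) ⟨i, by omega⟩ ⟨j + 1, by omega⟩)
    {Rb : Matrix (Fin k) (Fin k) K}
    (hRb : Rb = Matrix.of fun r s : Fin k =>
      (hankelT n q - μ • (1 : Matrix (Fin (n + 1)) (Fin (n + 1)) K)) ⟨a + r, by omega⟩ ⟨a + 1 + s, by omega⟩) :
    NN.det = TL.det * Rb.det := by
  subst hn
  set N := hankelT (a + k) q - μ • (1 : Matrix (Fin (a + k + 1)) (Fin (a + k + 1)) K) with hN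
  obtain ⟨hNa, -⟩ := hankelT_sub_pin_diag_odd (show a ≤ a + k by omega) hodd hqn hμ
  rw [← hN] at hNa
  have htri : N.BlockTriangular id := blockTriangular_hankelT_leading_sub hq0 μ
  refine det_of_lowerLeft_eq_zero (show a + k = a + k from rfl) NN (fun i j hj hi => ?_) ?_ ?_
  · rw [hNN, Matrix.of_apply]
    by_cases h : (j : ℕ) + 1 < (i : ℕ)
    · exact htri (show Fin.succ j < Fin.castSucc i from by rw [Fin.lt_def, Fin.val_succ, Fin.val_castSucc]; exact h)
    · have hji : (j : ℕ) + 1 = (i : ℕ) := by omega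
      have h1 : Fin.succ j = Fin.castSucc i := Fin.ext (by rw [Fin.val_succ, Fin.val_castSucc]; exact hji)
      have h2 : Fin.castSucc i = ⟨a, by omega⟩ := Fin.ext (by rw [Fin.val_castSucc]; show (i : ℕ) = a; omega)
      rw [h1, h2]; exact hNa
  · rw [hTL]; ext i j
    rw [Matrix.of_apply, Matrix.of_apply, hNN, Matrix.of_apply]
    congr 1
  · rw [hRb]; ext r s
    rw [Matrix.of_apply, Matrix.of_apply, hNN, Matrix.of_apply]
    congr 1; exact Fin.ext (by simp; omega)

/-- **THE I_Z DETERMINANT AT EVERY O_Z PIN, ODD `n`:** for an `I_Z` shape (`q_m = 0`, `1 ≤ m < n`), `n = a + k` odd, `q_n ≠ 0`,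
`μ_a = (−1)^a C(n,a) q_n`: `det(T_f(q) − μ_a) = (−1)ⁿ q_0 · (det TL_a · det R_a)`, the blocks taken from `N = T_f(q⁰) − μ_a`.
[cite: BourbakiAlgebre1a3, Ch. III §8] -/
theorem det_hankelT_idealShape_sub_pin_odd [CharZero K] {n a k : ℕ} (hn : n = a + k) (hodd : Odd n) (hn1 : 1 ≤ n)
    {q : ℕ → K} (hq : ∀ m, 1 ≤ m → m < n → q m = 0) (hqn : q n ≠ 0) {μ : K} (hμ : μ = (-1 : K) ^ a * (n.choose a : K) * q n)
    {TL : Matrix (Fin a) (Fin a) K}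
    (hTL : TL = Matrix.of fun i j : Fin a =>
      (hankelT n (Function.update q 0 0) - μ • (1 : Matrix (Fin (n + 1)) (Fin (n + 1)) K)) ⟨i, by omega⟩ ⟨j + 1, by omega⟩)
    {Rb : Matrix (Fin k) (Fin k) K}
    (hRb : Rb = Matrix.of fun r s : Fin k =>
      (hankelT n (Function.update q 0 0) - μ • (1 : Matrix (Fin (n + 1)) (Fin (n + 1)) K)) ⟨a + r, by omega⟩
        ⟨a + 1 + s, by omega⟩) :
    (hankelT n q - μ • (1 : Matrix (Fin (n + 1)) (Fin (n + 1)) K)).det = (-1 : K) ^ n * q 0 * (TL.det * Rb.det) := by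
  obtain ⟨hq0', hqn'⟩ := idealShape_update_zero hn1 hq
  have hμ' : μ = (-1 : K) ^ a * (n.choose a : K) * Function.update q 0 (0 : K) n := by rw [hqn']; exact hμ
  rw [det_hankelT_idealShape_sub n q μ rfl, det_hankelT_leading_sub_pin_eq_zero hq0' (by omega) hμ', zero_add,
    det_hessenberg_pin_eq_odd hn hodd hq0' (by rw [hqn']; exact hqn) hμ' rfl hTL hRb]

/-- **odd `n`: `±μ_a` is an eigenvalue of `T_f(q)` iff `det TL_a · det R_a = 0`** (`I_Z` shape, `q_0 ≠ 0`, `q_n ≠ 0`; the `+` sign by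
`det(T_f + c) = det(T_f − c)`). [cite: BourbakiAlgebre1a3, Ch. III §8] [cite: BuchweitzFlenner2008HH, Prop. 6.4.4] -/
theorem ker_hankelT_idealShape_sub_pin_odd_ne_bot_iff [CharZero K] {n a k : ℕ} (hn : n = a + k) (hodd : Odd n) (hn1 : 1 ≤ n)
    {q : ℕ → K} (hq : ∀ m, 1 ≤ m → m < n → q m = 0) (hq0 : q 0 ≠ 0) (hqn : q n ≠ 0) {μ : K}
    (hμ : μ = (-1 : K) ^ a * (n.choose a : K) * q n) {TL : Matrix (Fin a) (Fin a) K}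
    (hTL : TL = Matrix.of fun i j : Fin a =>
      (hankelT n (Function.update q 0 0) - μ • (1 : Matrix (Fin (n + 1)) (Fin (n + 1)) K)) ⟨i, by omega⟩ ⟨j + 1, by omega⟩)
    {Rb : Matrix (Fin k) (Fin k) K}
    (hRb : Rb = Matrix.of fun r s : Fin k =>
      (hankelT n (Function.update q 0 0) - μ • (1 : Matrix (Fin (n + 1)) (Fin (n + 1)) K)) ⟨a + r, by omega⟩
        ⟨a + 1 + s, by omega⟩) :
    (LinearMap.ker (Matrix.toLin' (hankelT n q) - μ • LinearMap.id) ≠ ⊥ ↔ TL.det * Rb.det = 0) ∧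
    (LinearMap.ker (Matrix.toLin' (hankelT n q) + μ • LinearMap.id) ≠ ⊥ ↔ TL.det * Rb.det = 0) := by
  have hdet := det_hankelT_idealShape_sub_pin_odd hn hodd hn1 hq hqn hμ hTL hRb
  have hdet' : (hankelT n q + μ • (1 : Matrix (Fin (n + 1)) (Fin (n + 1)) K)).det = (-1 : K) ^ n * q 0 * (TL.det * Rb.det) := by
    rw [det_hankelT_add_smul_eq_det_sub_of_odd hodd q μ, hdet]
  have hc : (-1 : K) ^ n * q 0 ≠ 0 := mul_ne_zero (pow_ne_zero _ (neg_ne_zero.mpr one_ne_zero)) hq0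
  have key : ∀ (M : Matrix (Fin (n + 1)) (Fin (n + 1)) K), M.det = (-1 : K) ^ n * q 0 * (TL.det * Rb.det) →
      (LinearMap.ker (Matrix.toLin' M) ≠ ⊥ ↔ TL.det * Rb.det = 0) := by
    intro M hM
    rw [ne_eq, Matrix.ker_toLin'_eq_bot_iff]
    constructor
    · intro h
      by_contra hne
      apply h
      intro v hv
      exact Matrix.eq_zero_of_mulVec_eq_zero (by rw [hM]; exact mul_ne_zero hc hne) hv
    · intro h hall
      obtain ⟨v, hv0, hv⟩ := Matrix.exists_mulVec_eq_zero_iff.mpr (show M.det = 0 by rw [hM, h, mul_zero])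
      exact hv0 (hall v hv)
  have hlin : Matrix.toLin' (hankelT n q) + μ • LinearMap.id =
      Matrix.toLin' (hankelT n q + μ • (1 : Matrix (Fin (n + 1)) (Fin (n + 1)) K)) := by
    rw [map_add, map_smul, Matrix.toLin'_one]
  refine ⟨?_, ?_⟩
  · rw [toLin'_sub_smul_id]; exact key _ hdet
  · rw [hlin]; exact key _ hdet'

end Summit.Ventures.HSemireg.Mod4
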